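import Summits.HubbardSuperconductivity.HubbardSuperconductivity.Theorems.AnisotropyChordTransferFibre3FinPiCell
import Summits.HubbardSuperconductivity.HubbardSuperconductivity.Theorems.AnisotropyChordTransferFibre3N1Row

/-!
# Route `AnisotropyChord` / H0 rotor rung: FIN — the named one/two-propagator sums EXACTLY at fixed `L` on a λ-cell (kernel evaluator + soundness)

The Level-2 rows of the GM₃ certificate (p2 `…Fibre3L2Vars`, `…N1RowExpr*`, `…N1RowCheckSound`) are `RExpr` inequalities over the
sixteen-variable vector `L2.point L λ₂ a`, twelve of whose coordinates are the normalised named sums of PartN41-B (`…Fibre3N1Row`: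
`S2n … G13n = B1.torSum L λ₂ s a`, `TxSum L λ₂ q`).  For `L ≥ L₀` they are bracketed L-free (B1); for the FIN range `L < L₀` THIS FILE
evaluates them EXACTLY at the given `L`, for every `λ` of a fixed-point cell `λ·D ∈ [la, lb]`, with g4's layer-0 cell reciprocal table
(`…FinGreenCell`: `gresCellTab`, `denCellPos`; `1/(2ε(k) − λ)` is monotone in `λ`) — no window, no tail constant, `O(V)` per sum:
* `ione`, `ipow`, `modNat` (integer momentum coordinate ↦ natural representative), `gAt` (the table with the EXACT zero of `gres` at
  the zero momentum), `facIv`, `termIv`, ★ `torSumIv L gt s a` — enclosure of `B1.torSum L λ s a = Σ_k Π_i g(k + s_i)^{a_i}`;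
* `txTermIv`, ★ `txSumIv L gt ct2 q` — enclosure of `TxSum L λ q = Σ_p g(p) g(q − p) cos(2πp₁/L − πq₁/L)` (signed cos weights from
  the cosine table at modulus `2L`);
* soundness: `mem_one`, `mem_zero`, `mem_ipow`, `mem_foldr_ofFn`, `modNat_lt`, `modNat_cast`, `natPair_add_toTor`, `toTor_sub_natPair`,
  `mem_gAt`, `mem_facIv`, `mem_termIv`, ★ `mem_torSum_cell`, `mem_txWeight`, `mem_txTermIv`, ★ `mem_txSum_cell`.
The box over all sixteen variables and the bridge `fin_point_mem_box` are `…Fibre3FinNamedCell`.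
Prover seat `hubbard-h0-rotor-p3` g5; helper for piece A = stmt-HubbardSuperconductivity-23918 of rung 19089 (`--supports`, helper
class).  WHAT THIS IS NOT: nothing here proves superconductivity in the Hubbard model (rotor TARGET as worded stays FALSE, g15 verdict);
evaluator infrastructure for the FIN certificates of ONE conditional reduction.  Tree imports only; no sorry, no new axioms.
-/

set_option linter.dupNamespace false
set_option autoImplicit false

namespace Summit.HubbardSuperconductivity.HubbardSuperconductivity.Theorems.AnisotropyChord.Transfer.Fibre3

namespace FinCell

open scoped BigOperators
open Finset Hole2

/-! ## The evaluator (computable, zero data) -/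

/-- the exact fixed-point `1`. [folklore] -/
def ione : Iv := (D, D)

/-- interval power by repeated multiplication (`I⁰ = 1`). [folklore] -/
def ipow (I : Iv) : ℕ → Iv
  | 0 => ione
  | n + 1 => imul (ipow I n) I

/-- the natural representative of an integer momentum coordinate: `(z mod L) ∈ [0, L)`. [folklore] -/
def modNat (L : ℕ) (z : ℤ) : ℕ := (z % (L : ℤ)).toNat

/-- the cell table read with the EXACT zero of `gres` at the zero momentum. [folklore] -/
def gAt (gt : List (List Iv)) (i j : ℕ) : Iv := if i = 0 ∧ j = 0 then (0, 0) else getF gt i j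

/-- one factor `g(k + s)^a` at natural coordinates `k = (k₁,k₂)` (shifted index mod `L`). [folklore] -/
def facIv (L : ℕ) (gt : List (List Iv)) (k1 k2 : ℕ) (s : ℤ × ℤ) (a : ℕ) : Iv :=
  ipow (gAt gt (modNat L ((k1 : ℤ) + s.1)) (modNat L ((k2 : ℤ) + s.2))) a

/-- the product `Π_i g(k + s_i)^{a_i}` at natural coordinates. [folklore] -/
def termIv (L : ℕ) (gt : List (List Iv)) {m : ℕ} (s : Fin m → ℤ × ℤ) (a : Fin m → ℕ) (k1 k2 : ℕ) : Iv :=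
  (List.ofFn fun i => facIv L gt k1 k2 (s i) (a i)).foldr imul ione

/-- ★ enclosure of `B1.torSum L λ s a = Σ_k Π_i g(k + s_i)^{a_i}` on the cell of the table `gt`. [folklore] -/
def torSumIv (L : ℕ) (gt : List (List Iv)) {m : ℕ} (s : Fin m → ℤ × ℤ) (a : Fin m → ℕ) : Iv :=
  psum (fun k1 => psum (fun k2 => termIv L gt s a k1 k2) L) L

/-- one term `g(p) g(q − p) cos(2π(2p₁ − q₁)/(2L))` of `TxSum` (`ct2` = the cosine table at modulus `2L`). [folklore] -/
def txTermIv (L : ℕ) (gt : List (List Iv)) (ct2 : List Iv) (q : ℤ × ℤ) (p1 p2 : ℕ) : Iv :=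
  imul (imul (gAt gt p1 p2) (gAt gt (modNat L (q.1 - p1)) (modNat L (q.2 - p2))))
    (getIv ct2 (modNat (2 * L) (2 * (p1 : ℤ) - q.1)))

/-- ★ enclosure of `TxSum L λ q` on the cell of the table `gt`. [folklore] -/
def txSumIv (L : ℕ) (gt : List (List Iv)) (ct2 : List Iv) (q : ℤ × ℤ) : Iv :=
  psum (fun p1 => psum (fun p2 => txTermIv L gt ct2 q p1 p2) L) L

/-! ## Soundness of the arithmetic pieces -/

/-- `1 ∈ ione`. [folklore] -/
theorem mem_one : mem 1 ione := by
  have h := mem_exact D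
  rwa [div_self (ne_of_gt D_pos)] at h

/-- `0 ∈ (0,0)`. [folklore] -/
theorem mem_zero : mem 0 ((0 : ℤ), (0 : ℤ)) := by
  have h := mem_exact 0
  push_cast at h
  rwa [zero_div] at h

/-- powers. [folklore] -/
theorem mem_ipow {x : ℝ} {I : Iv} (hx : mem x I) : ∀ n : ℕ, mem (x ^ n) (ipow I n)
  | 0 => by rw [pow_zero]; exact mem_one
  | n + 1 => by rw [pow_succ]; exact mem_imul (mem_ipow hx n) hx

/-- a product over `Fin m` against the folded list of enclosures. [folklore] -/
theorem mem_foldr_ofFn : ∀ {m : ℕ} (F : Fin m → Iv) (x : Fin m → ℝ), (∀ i, mem (x i) (F i)) →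
    mem (∏ i, x i) ((List.ofFn F).foldr imul ione)
  | 0, F, x, _ => by
      rw [List.ofFn_zero, List.foldr_nil, Fintype.prod_empty]
      exact mem_one
  | m + 1, F, x, h => by
      rw [List.ofFn_succ, List.foldr_cons, Fin.prod_univ_succ]
      exact mem_imul (h 0) (mem_foldr_ofFn (fun i => F i.succ) (fun i => x i.succ) (fun i => h i.succ))

/-! ## Momentum indices -/

/-- `modNat L z < L`. [folklore] -/
theorem modNat_lt (L : ℕ) (hL : 0 < L) (z : ℤ) : modNat L z < L := by
  unfold modNat
  have hL' : (0 : ℤ) < L := by exact_mod_cast hL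
  have h0 : 0 ≤ z % (L : ℤ) := Int.emod_nonneg z (ne_of_gt hL')
  have h1 : z % (L : ℤ) < L := Int.emod_lt_of_pos z hL'
  omega

/-- `modNat L z` read in `ZMod L` is `z`. [folklore] -/
theorem modNat_cast (L : ℕ) (hL : 0 < L) (z : ℤ) : (((modNat L z : ℕ)) : ZMod L) = ((z : ℤ) : ZMod L) := by
  unfold modNat
  have hL' : (0 : ℤ) < L := by exact_mod_cast hL
  have h0 : 0 ≤ z % (L : ℤ) := Int.emod_nonneg z (ne_of_gt hL')
  rw [← Int.cast_natCast, Int.toNat_of_nonneg h0, ZMod.intCast_mod]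

/-- the shifted momentum at natural coordinates. [folklore] -/
theorem natPair_add_toTor (L : ℕ) [NeZero L] (k1 k2 : ℕ) (s : ℤ × ℤ) :
    ((((k1 : ℕ) : ZMod L), ((k2 : ℕ) : ZMod L)) : Tor L) + B1.toTor L s
      = (((modNat L ((k1 : ℤ) + s.1) : ℕ) : ZMod L), ((modNat L ((k2 : ℤ) + s.2) : ℕ) : ZMod L)) := by
  have hL : 0 < L := Nat.pos_of_ne_zero (NeZero.ne L)
  rw [modNat_cast L hL, modNat_cast L hL]
  refine Prod.ext ?_ ?_ <;> simp [B1.toTor]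

/-- the reflected momentum `q − p` at natural coordinates. [folklore] -/
theorem toTor_sub_natPair (L : ℕ) [NeZero L] (p1 p2 : ℕ) (q : ℤ × ℤ) :
    B1.toTor L q - ((((p1 : ℕ) : ZMod L), ((p2 : ℕ) : ZMod L)) : Tor L)
      = (((modNat L (q.1 - p1) : ℕ) : ZMod L), ((modNat L (q.2 - p2) : ℕ) : ZMod L)) := by
  have hL : 0 < L := Nat.pos_of_ne_zero (NeZero.ne L)
  rw [modNat_cast L hL, modNat_cast L hL]
  refine Prod.ext ?_ ?_ <;> simp [B1.toTor]

/-! ## Soundness of the factors and sums -/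

/-- the table read with the exact zero encloses `gres` at every natural momentum. [folklore] -/
theorem mem_gAt (L : ℕ) [NeZero L] (hL : 3 ≤ L) {lam : ℝ} {la lb : ℤ}
    (hla : (la : ℝ) ≤ lam * ((D : ℤ) : ℝ)) (hlb : lam * ((D : ℤ) : ℝ) ≤ (lb : ℝ))
    (hpos : denCellPos L (cosTab L) la lb = true) {i j : ℕ} (hi : i < L) (hj : j < L) :
    mem (gres L lam (((i : ℕ) : ZMod L), ((j : ℕ) : ZMod L))) (gAt (gresCellTab L (cosTab L) la lb) i j) := by
  unfold gAt gres
  have hzero : ((((i : ℕ) : ZMod L), ((j : ℕ) : ZMod L)) : Tor L) = 0 ↔ (i = 0 ∧ j = 0) := by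
    rw [Prod.mk_eq_zero, natCast_zmod_eq_zero L hi, natCast_zmod_eq_zero L hj]
  by_cases hk : i = 0 ∧ j = 0
  · rw [if_pos (hzero.mpr hk), if_pos hk]
    exact mem_zero
  · rw [if_neg (fun h => hk (hzero.mp h)), if_neg hk, epsT_natCast L hi hj]
    have h := mem_gresCellTab L hL hla hlb hpos i j hi hj hk
    unfold gw epsN at h
    exact h

/-- one factor. [folklore] -/
theorem mem_facIv (L : ℕ) [NeZero L] (hL : 3 ≤ L) {lam : ℝ} {la lb : ℤ}
    (hla : (la : ℝ) ≤ lam * ((D : ℤ) : ℝ)) (hlb : lam * ((D : ℤ) : ℝ) ≤ (lb : ℝ))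
    (hpos : denCellPos L (cosTab L) la lb = true) (k1 k2 : ℕ) (s : ℤ × ℤ) (a : ℕ) :
    mem (gres L lam (((((k1 : ℕ) : ZMod L), ((k2 : ℕ) : ZMod L)) : Tor L) + B1.toTor L s) ^ a)
      (facIv L (gresCellTab L (cosTab L) la lb) k1 k2 s a) := by
  have hL0 : 0 < L := by omega
  rw [natPair_add_toTor]
  unfold facIv
  exact mem_ipow (mem_gAt L hL hla hlb hpos (modNat_lt L hL0 _) (modNat_lt L hL0 _)) a

/-- one product term. [folklore] -/
theorem mem_termIv (L : ℕ) [NeZero L] (hL : 3 ≤ L) {lam : ℝ} {la lb : ℤ}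
    (hla : (la : ℝ) ≤ lam * ((D : ℤ) : ℝ)) (hlb : lam * ((D : ℤ) : ℝ) ≤ (lb : ℝ))
    (hpos : denCellPos L (cosTab L) la lb = true) {m : ℕ} (s : Fin m → ℤ × ℤ) (a : Fin m → ℕ) (k1 k2 : ℕ) :
    mem (∏ i, gres L lam (((((k1 : ℕ) : ZMod L), ((k2 : ℕ) : ZMod L)) : Tor L) + B1.toTor L (s i)) ^ a i)
      (termIv L (gresCellTab L (cosTab L) la lb) s a k1 k2) := by
  unfold termIv
  exact mem_foldr_ofFn _ _ fun i => mem_facIv L hL hla hlb hpos k1 k2 (s i) (a i)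

/-- ★ THE CELL ENCLOSURE of a family-B1 torus sum at THIS `L`: for every `λ` with `λ·D ∈ [la, lb]` (and the positivity check),
`B1.torSum L λ s a ∈ torSumIv L (gresCellTab L (cosTab L) la lb) s a`. [folklore] -/
theorem mem_torSum_cell (L : ℕ) [NeZero L] (hL : 3 ≤ L) {lam : ℝ} {la lb : ℤ}
    (hla : (la : ℝ) ≤ lam * ((D : ℤ) : ℝ)) (hlb : lam * ((D : ℤ) : ℝ) ≤ (lb : ℝ))
    (hpos : denCellPos L (cosTab L) la lb = true) {m : ℕ} (s : Fin m → ℤ × ℤ) (a : Fin m → ℕ) :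
    mem (B1.torSum L lam s a) (torSumIv L (gresCellTab L (cosTab L) la lb) s a) := by
  unfold B1.torSum torSumIv
  rw [sum_tor_range]
  exact mem_psum _ _ L fun k1 _ => mem_psum _ _ L fun k2 _ => mem_termIv L hL hla hlb hpos s a k1 k2

/-- the cos weight of `TxSum` from the table at modulus `2L`. [folklore] -/
theorem mem_txWeight (L : ℕ) (hL : 3 ≤ L) (p1 : ℕ) (q1 : ℤ) :
    mem (Real.cos (2 * Real.pi * p1 / L - Real.pi * q1 / L)) (getIv (cosTab (2 * L)) (modNat (2 * L) (2 * (p1 : ℤ) - q1))) := by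
  have h2L : 3 ≤ 2 * L := by omega
  have h2L0 : 0 < 2 * L := by omega
  have hw := modNat_lt (2 * L) h2L0 (2 * (p1 : ℤ) - q1)
  rw [getIv_cosTab hw]
  have hc := mem_cosIv h2L hw
  have hM : (0 : ℤ) < ((2 * L : ℕ) : ℤ) := by exact_mod_cast h2L0
  have h0 : 0 ≤ (2 * (p1 : ℤ) - q1) % ((2 * L : ℕ) : ℤ) := Int.emod_nonneg _ (ne_of_gt hM)
  have hz : (((modNat (2 * L) (2 * (p1 : ℤ) - q1) : ℕ) : ℤ)) = (2 * (p1 : ℤ) - q1) % ((2 * L : ℕ) : ℤ) := by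
    unfold modNat
    rw [Int.toNat_of_nonneg h0]
  have hdiv : (2 * (p1 : ℤ) - q1) % ((2 * L : ℕ) : ℤ) + ((2 * L : ℕ) : ℤ) * ((2 * (p1 : ℤ) - q1) / ((2 * L : ℕ) : ℤ))
      = 2 * (p1 : ℤ) - q1 := Int.emod_add_mul_ediv _ _
  have hzR : (((modNat (2 * L) (2 * (p1 : ℤ) - q1) : ℕ) : ℝ))
      = 2 * (p1 : ℝ) - (q1 : ℝ) - 2 * (L : ℝ) * ((((2 * (p1 : ℤ) - q1) / ((2 * L : ℕ) : ℤ) : ℤ)) : ℝ) := by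
    have h1 := congrArg (fun z : ℤ => (z : ℝ)) hz
    have h2 := congrArg (fun z : ℤ => (z : ℝ)) hdiv
    push_cast at h1 h2 ⊢
    linarith
  have hLr : (L : ℝ) ≠ 0 := by exact_mod_cast (show L ≠ 0 by omega)
  have e : 2 * Real.pi * p1 / L - Real.pi * q1 / L
      = 2 * Real.pi * (((modNat (2 * L) (2 * (p1 : ℤ) - q1) : ℕ) : ℝ)) / ((2 * L : ℕ) : ℝ)
        + ((((2 * (p1 : ℤ) - q1) / ((2 * L : ℕ) : ℤ) : ℤ)) : ℝ) * (2 * Real.pi) := by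
    rw [hzR]
    push_cast
    field_simp
    ring
  rw [e, Real.cos_add_int_mul_two_pi]
  exact hc

/-- one term of `TxSum`. [folklore] -/
theorem mem_txTermIv (L : ℕ) [NeZero L] (hL : 3 ≤ L) {lam : ℝ} {la lb : ℤ}
    (hla : (la : ℝ) ≤ lam * ((D : ℤ) : ℝ)) (hlb : lam * ((D : ℤ) : ℝ) ≤ (lb : ℝ))
    (hpos : denCellPos L (cosTab L) la lb = true) (q : ℤ × ℤ) {p1 p2 : ℕ} (hp1 : p1 < L) (hp2 : p2 < L) :
    mem (gres L lam ((((p1 : ℕ) : ZMod L), ((p2 : ℕ) : ZMod L)))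
          * gres L lam (B1.toTor L q - ((((p1 : ℕ) : ZMod L), ((p2 : ℕ) : ZMod L))))
          * Real.cos (2 * Real.pi * ((((p1 : ℕ) : ZMod L)).val) / L - Real.pi * q.1 / L))
      (txTermIv L (gresCellTab L (cosTab L) la lb) (cosTab (2 * L)) q p1 p2) := by
  have hL0 : 0 < L := by omega
  rw [toTor_sub_natPair, ZMod.val_natCast, Nat.mod_eq_of_lt hp1]
  unfold txTermIv
  exact mem_imul (mem_imul (mem_gAt L hL hla hlb hpos hp1 hp2)
    (mem_gAt L hL hla hlb hpos (modNat_lt L hL0 _) (modNat_lt L hL0 _))) (mem_txWeight L hL p1 q.1)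

/-- ★ THE CELL ENCLOSURE of `TxSum L λ q` at THIS `L`. [folklore] -/
theorem mem_txSum_cell (L : ℕ) [NeZero L] (hL : 3 ≤ L) {lam : ℝ} {la lb : ℤ}
    (hla : (la : ℝ) ≤ lam * ((D : ℤ) : ℝ)) (hlb : lam * ((D : ℤ) : ℝ) ≤ (lb : ℝ))
    (hpos : denCellPos L (cosTab L) la lb = true) (q : ℤ × ℤ) :
    mem (TxSum L lam q) (txSumIv L (gresCellTab L (cosTab L) la lb) (cosTab (2 * L)) q) := by
  unfold TxSum txSumIv
  rw [sum_tor_range]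
  refine mem_psum _ _ L fun p1 hp1 => mem_psum _ _ L fun p2 hp2 => ?_
  exact mem_txTermIv L hL hla hlb hpos q hp1 hp2

end FinCell

end Summit.HubbardSuperconductivity.HubbardSuperconductivity.Theorems.AnisotropyChord.Transfer.Fibre3
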